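import Summits.AnomalousDissipation.AnomalousDissipation.Theorems.SolenoidalFractalHomogenisationLagrangianStepFrameBackwardEntries
import Summits.AnomalousDissipation.AnomalousDissipation.Theorems.SolenoidalFractalHomogenisationLagrangianStepFrameTestLipschitz
import Summits.AnomalousDissipation.AnomalousDissipation.Theorems.SolenoidalFractalHomogenisationLagrangianStepClosedWindow
import Summits.AnomalousDissipation.AnomalousDissipation.Theorems.SolenoidalFractalHomogenisationLagrangianStepFrameConjugacyAssemblyCurve
import Literature.Analysis.FunctionSpaces.TorusHolderBridge
import HarnessLib

/-!
# K1L_D (stmt-AnomalousDissipation-27980), v2 road step (3): the backward reading of a time-Lipschitz test is TIME-LIPSCHITZ — tools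
# (helper, `--supports 27980 --as helper`; prover lead-k1l-onelevel-p1 g7; memo L22 §4 (3))

For the converse of (C6) the Eulerian test `Φ τ x := Ψ τ (X m r₀ (t′ τ) x)` of an admissible distorted test `Ψ` must be Lipschitz in `τ`
uniformly in `x`.  No time derivative of the BACKWARD map is needed: by the group law `X m r₀ s₂ = X m r₀ s₁ ∘ X m s₁ s₂`, one only needs
(i) a SPATIAL Lipschitz bound of torus maps from a derivative bound (`norm_sub_le_of_partialDeriv_le`: good lifts `‖a − b‖ ≤ √3·dist`,
`Torus.exists_lift_norm_sub_le`, + the mean value inequality on `ℝ³`), (ii) the spatial Lipschitz bound of the backward maps `X m r₀ s` uniformly on a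
window from a bound on the frame entries (`dist_X_backward_le`: `D(X m r₀ s) = frameG ∘ X m r₀ s`, `flowDeriv_backward_apply`), and (iii) the FORWARD
displacement bound `dist (X m s₁ r₀ y) (X m s₂ r₀ y) ≤ C_b |s₁ − s₂|` (`dist_X_forward_le`, `hasDerivAt_disp` + `exists_norm_partialSum_le`).
The assembled statement is `exists_lipschitz_comp_backward`.
No sorry, no definition, no named fact.  NOT a proof of the converse reading lemma, of `stub_Vmod_EHTthg`, of K1L_D or AD; rung F-D1.A0.
-/

set_option linter.dupNamespace false

noncomputable section

namespace Summit.AnomalousDissipation.AnomalousDissipation.Theorems.SolenoidalFractalHomogenisation.LagrangianStep.FrameConj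

open Set Function Filter MeasureTheory Topology
open scoped NNReal ENNReal InnerProductSpace ContDiff
open Literature.Analysis Literature.Analysis.FunctionSpaces Literature.Analysis.FunctionSpaces.Torus
open Literature.Analysis.FluidPDE Literature.Analysis.FluidPDE.LatticeShear
open Literature.Analysis.FluidPDE.LatticeShear (LagrangianLatticeCarrier)

variable {k : ℕ}
variable {F : Type*} [NormedAddCommGroup F] [NormedSpace ℝ F]

/-! ## §1 Spatial Lipschitz bound on the torus from a bound on the partial derivatives -/

/-- **Mean value on the torus**: a `C¹` map with `‖∂_i f‖ ≤ M` everywhere is `3M√3`-Lipschitz for the intrinsic metric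
(good lifts `‖a − b‖ ≤ √3·dist x y` + the mean value inequality for the lift on `ℝ³`). -/
theorem norm_sub_le_of_partialDeriv_le {f : UnitAddTorus (Fin 3) → F} (hf : IsSmooth f) {M : ℝ} (hM0 : 0 ≤ M)
    (hM : ∀ i y, ‖Torus.partialDeriv i f y‖ ≤ M) (x y : UnitAddTorus (Fin 3)) :
    ‖f x - f y‖ ≤ 3 * M * Real.sqrt 3 * dist x y := by
  have hf1 : IsContDiff 1 f := hf.isContDiff (by simp)
  -- the lift is `3M`-Lipschitz on `ℝ³`
  have hD : ∀ a : EuclideanSpace ℝ (Fin 3), ‖fderiv ℝ (lift f) a‖ ≤ 3 * M := by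
    intro a
    rw [fderiv_lift]
    refine ContinuousLinearMap.opNorm_le_bound _ (by positivity) fun w => ?_
    rw [fderiv_apply_eq_sum_partialDeriv hf1]
    calc ‖∑ i, w i • Torus.partialDeriv i f (proj a)‖ ≤ ∑ i, ‖w i • Torus.partialDeriv i f (proj a)‖ := norm_sum_le _ _
      _ ≤ ∑ _i : Fin 3, ‖w‖ * M := Finset.sum_le_sum fun i _ => by
          rw [norm_smul]
          exact mul_le_mul (by simpa using PiLp.norm_apply_le w i) (hM i _) (norm_nonneg _) (norm_nonneg _)
      _ = 3 * M * ‖w‖ := by simp [Finset.sum_const]; ring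
  have hdiff : Differentiable ℝ (lift f) := (hf1 : ContDiff ℝ 1 (lift f)).differentiable (by simp)
  have hlip : LipschitzWith (Real.toNNReal (3 * M)) (lift f) :=
    lipschitzWith_of_nnnorm_fderiv_le hdiff fun a => by
      rw [← NNReal.coe_le_coe, coe_nnnorm, Real.coe_toNNReal _ (by positivity)]; exact hD a
  obtain ⟨a, b, rfl, rfl, hab⟩ := exists_lift_norm_sub_le x y
  have h1 := hlip.norm_sub_le a b
  rw [lift_apply, lift_apply, Real.coe_toNNReal _ (by positivity)] at h1
  have hcard : Real.sqrt (Fintype.card (Fin 3)) = Real.sqrt 3 := by simp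
  rw [hcard] at hab
  calc ‖f (proj a) - f (proj b)‖ ≤ 3 * M * ‖a - b‖ := h1
    _ ≤ 3 * M * (Real.sqrt 3 * dist (proj a) (proj b)) := mul_le_mul_of_nonneg_left hab (by positivity)
    _ = 3 * M * Real.sqrt 3 * dist (proj a) (proj b) := by ring

/-- `‖z‖ ≤ Σ_l |z_l|` on `ℝ³` (basis expansion). -/
theorem norm_le_sum_abs_fin3 (z : EuclideanSpace ℝ (Fin 3)) : ‖z‖ ≤ ∑ l, |z l| := by
  have hz : z = ∑ l, z l • EuclideanSpace.single l (1:ℝ) := by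
    simpa using ((EuclideanSpace.basisFun (Fin 3) ℝ).sum_repr z).symm
  calc ‖z‖ = ‖∑ l, z l • EuclideanSpace.single l (1:ℝ)‖ := by rw [← hz]
    _ ≤ ∑ l, ‖z l • EuclideanSpace.single l (1:ℝ)‖ := norm_sum_le _ _
    _ = ∑ l, |z l| := Finset.sum_congr rfl fun l _ => by rw [norm_smul, Real.norm_eq_abs]; simp

/-! ## §2 Spatial Lipschitz bound of the backward maps from a frame bound -/

/-- **The backward map is Lipschitz in space** when the frame entries at the image points are bounded: with `|frameG E m s r₀ (X m r₀ s x) c i| ≤ B`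
for all `x c i`, `dist (X m r₀ s x) (X m r₀ s x′) ≤ (1 + 3(3B+1))·√3·dist x x′` (crude: the displacement `disp m r₀ s` has `‖∂_i disp‖ ≤ 3B + 1`). -/
theorem dist_X_backward_le (E : LagrangianLatticeCarrier k) (hR : E.LevelRegular) (m : ℕ) (r₀ s : ℝ) {B : ℝ} (hB0 : 0 ≤ B)
    (hB : ∀ (x : UnitAddTorus (Fin 3)) (c i : Fin 3), |frameG E m s r₀ (E.X m r₀ s x) c i| ≤ B) (x x' : UnitAddTorus (Fin 3)) :
    dist (E.X m r₀ s x) (E.X m r₀ s x') ≤ (1 + 3 * (3 * B + 1)) * (Real.sqrt 3 * dist x x') := by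
  -- partial derivatives of the backward displacement
  have hD : IsSmooth (E.disp m r₀ s) := hR.isSmooth_disp m r₀ s
  have hD1 : IsContDiff 1 (E.disp m r₀ s) := hD.isContDiff (by simp)
  have hpd : ∀ (i : Fin 3) (y : UnitAddTorus (Fin 3)), ‖Torus.partialDeriv i (E.disp m r₀ s) y‖ ≤ 3 * B + 1 := by
    intro i y
    rw [partialDeriv_eq_fderiv_apply hD1]
    have e : Torus.fderiv (E.disp m r₀ s) y (EuclideanSpace.single i 1)
        = E.flowDeriv m r₀ s y (EuclideanSpace.single i 1) - EuclideanSpace.single i 1 := by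
      rw [flowDeriv_eq_id_add_fderiv]
      simp
    rw [e, flowDeriv_backward_apply E hR m r₀ s y]
    refine (norm_sub_le _ _).trans (add_le_add ?_ (by simp))
    refine (norm_le_sum_abs_fin3 _).trans ?_
    calc ∑ c, |(WithLp.toLp 2 ((frameG E m s r₀ (E.X m r₀ s y)).mulVec (WithLp.ofLp (EuclideanSpace.single i (1:ℝ)))) : EuclideanSpace ℝ (Fin 3)) c|
        = ∑ c, |frameG E m s r₀ (E.X m r₀ s y) c i| := Finset.sum_congr rfl fun c _ => by
          congr 1
          simp [Matrix.mulVec, dotProduct]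
      _ ≤ ∑ _c : Fin 3, B := Finset.sum_le_sum fun c _ => hB y c i
      _ = 3 * B := by simp [Finset.sum_const]
  -- good lifts and the mean value inequality for the lifted displacement
  obtain ⟨a, b, hax, hbx, hab⟩ := exists_lift_norm_sub_le x x'
  have hcard : Real.sqrt (Fintype.card (Fin 3)) = Real.sqrt 3 := by simp
  rw [hcard] at hab
  have hdisp : ‖E.disp m r₀ s x - E.disp m r₀ s x'‖ ≤ 3 * (3 * B + 1) * Real.sqrt 3 * dist x x' :=
    norm_sub_le_of_partialDeriv_le hD (by positivity) hpd x x'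
  -- `X z = proj (lift z + disp z)`
  have hX : ∀ (z : EuclideanSpace ℝ (Fin 3)), E.X m r₀ s (proj z) = proj (z + E.disp m r₀ s (proj z)) := fun z => by
    rw [LagrangianLatticeCarrier.X_apply, proj_add]
  rw [← hax, ← hbx, hX a, hX b]
  have h1 := lipschitzWith_proj.dist_le_mul (a + E.disp m r₀ s (proj a)) (b + E.disp m r₀ s (proj b))
  rw [NNReal.coe_one, one_mul, dist_eq_norm (a + E.disp m r₀ s (proj a)) (b + E.disp m r₀ s (proj b))] at h1
  refine h1.trans ?_
  rw [hax, hbx]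
  calc ‖a + E.disp m r₀ s x - (b + E.disp m r₀ s x')‖ = ‖(a - b) + (E.disp m r₀ s x - E.disp m r₀ s x')‖ := by congr 1; abel
    _ ≤ ‖a - b‖ + ‖E.disp m r₀ s x - E.disp m r₀ s x'‖ := norm_add_le _ _
    _ ≤ Real.sqrt 3 * dist x x' + 3 * (3 * B + 1) * Real.sqrt 3 * dist x x' := add_le_add hab hdisp
    _ = (1 + 3 * (3 * B + 1)) * (Real.sqrt 3 * dist x x') := by ring

/-! ## §3 The forward displacement bound in time -/

/-- **Forward displacement in time**: `dist (X m s₁ r₀ y) (X m s₂ r₀ y) ≤ C_b·|s₁ − s₂|`, `C_b = sup ‖b_{≤m}‖` (mean value on the displacement,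
`hasDerivAt_disp`, and `proj` is 1-Lipschitz). -/
theorem dist_X_forward_le (E : LagrangianLatticeCarrier k) (hR : E.LevelRegular) {m : ℕ} (hF : E.IsFlow m) (r₀ : ℝ) {Cb : ℝ}
    (hCb : ∀ t' x, ‖E.partialSum m t' x‖ ≤ Cb) (s₁ s₂ : ℝ) (y : UnitAddTorus (Fin 3)) :
    dist (E.X m s₁ r₀ y) (E.X m s₂ r₀ y) ≤ Cb * |s₁ - s₂| := by
  have hderiv : ∀ t', HasDerivAt (fun t'' => E.disp m t'' r₀ y) (E.partialSum m t' (E.X m t' r₀ y)) t' :=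
    fun t' => hasDerivAt_disp E hR hF r₀ t' y
  have hMVT : ‖E.disp m s₁ r₀ y - E.disp m s₂ r₀ y‖ ≤ Cb * ‖s₁ - s₂‖ :=
    Convex.norm_image_sub_le_of_norm_hasDerivWithin_le (s := univ) (fun t' _ => (hderiv t').hasDerivWithinAt)
      (fun t' _ => hCb _ _) convex_univ (mem_univ s₂) (mem_univ s₁)
  rw [Real.norm_eq_abs] at hMVT
  rw [LagrangianLatticeCarrier.X_apply, LagrangianLatticeCarrier.X_apply, dist_add_left]
  have h1 := lipschitzWith_proj.dist_le_mul (E.disp m s₁ r₀ y) (E.disp m s₂ r₀ y)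
  rw [NNReal.coe_one, one_mul, dist_eq_norm (E.disp m s₁ r₀ y) (E.disp m s₂ r₀ y)] at h1
  exact h1.trans hMVT

/-! ## §4 The backward reading of an admissible distorted test is time-Lipschitz -/

/-- The clamp is 1-Lipschitz. -/
theorem abs_clamp_sub_clamp_le (u v c : ℝ) : |max 0 (min u c) - max 0 (min v c)| ≤ |u - v| := by
  have h1 := abs_max_sub_max_le_max (0:ℝ) (min u c) 0 (min v c)
  have h2 := abs_min_sub_min_le_max u c v c
  rw [sub_self, abs_zero] at h1 h2
  have h3 : max 0 |min u c - min v c| = |min u c - min v c| := max_eq_right (abs_nonneg _)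
  have h4 : max |u - v| 0 = |u - v| := max_eq_left (abs_nonneg _)
  rw [h3] at h1; rw [h4] at h2
  exact h1.trans h2

/-- **The backward reading `τ ↦ Ψ τ (X m jR (jR + clamp(σ₁+τ)/a) x)` of a time-Lipschitz space-smooth test is Lipschitz in `τ` on `[0,T]`,
uniformly in `x`** (closed piece `[jR, t]`, any base shift `σ₁`, any horizon `T` of `Ψ`; constant from the time-Lipschitz constant of `Ψ`, the bound on `∂Ψ`, the frame bound on the
closed window, and `sup ‖b_{≤m}‖`). -/
theorem exists_lipschitz_comp_backward (E : LagrangianLatticeCarrier k) (hR : E.LevelRegular) {m : ℕ} (hF : E.IsFlow m) (j : ℤ)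
    {t T : ℝ} (σ₁ : ℝ) (hjt : (j : ℝ) * E.refresh (m + 1) ≤ t) (htR : t ≤ (j : ℝ) * E.refresh (m + 1) + E.refresh (m + 1))
    {Ψ : ℝ → UnitAddTorus (Fin 3) → F} (hΨ : Torus.IsLipschitzSpaceTimeTest T Ψ) :
    ∃ L : ℝ, 0 ≤ L ∧ ∀ τ₁ ∈ Icc 0 T, ∀ τ₂ ∈ Icc 0 T, ∀ x : UnitAddTorus (Fin 3),
      ‖Ψ τ₁ (E.X m ((j : ℝ) * E.refresh (m + 1)) ((j : ℝ) * E.refresh (m + 1)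
            + max 0 (min (σ₁ + τ₁) (E.a (m + 1) * (t - (j : ℝ) * E.refresh (m + 1)))) / E.a (m + 1)) x)
        - Ψ τ₂ (E.X m ((j : ℝ) * E.refresh (m + 1)) ((j : ℝ) * E.refresh (m + 1)
            + max 0 (min (σ₁ + τ₂) (E.a (m + 1) * (t - (j : ℝ) * E.refresh (m + 1)))) / E.a (m + 1)) x)‖ ≤ L * |τ₁ - τ₂| := by
  set w : ℝ := (j : ℝ) * E.refresh (m + 1) with hw
  set Tw : ℝ := E.a (m + 1) * (t - w) with hTw
  have ha : 0 < E.a (m + 1) := E.a_pos (m + 1)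
  have hTw0 : 0 ≤ Tw := mul_nonneg ha.le (by linarith)
  -- constants
  obtain ⟨LΨ, hLΨ0, hLΨ⟩ := hΨ.lipschitz
  have hMex : ∃ M : ℝ, ∀ τ ∈ Icc 0 T, ∀ (i : Fin 3) (y : UnitAddTorus (Fin 3)), ‖Torus.partialDeriv i (Ψ τ) y‖ ≤ M := by
    have hK : IsCompact (Icc (0:ℝ) T ×ˢ (univ : Set (UnitAddTorus (Fin 3)))) := isCompact_Icc.prod isCompact_univ
    have hb : ∀ i : Fin 3, ∃ Mi : ℝ, ∀ p ∈ Icc (0:ℝ) T ×ˢ (univ : Set (UnitAddTorus (Fin 3))),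
        ‖(uncurry fun (τ : ℝ) (y : UnitAddTorus (Fin 3)) => Torus.partialDeriv i (Ψ τ) y) p‖ ≤ Mi :=
      fun i => hK.exists_bound_of_continuousOn (hΨ.continuous_uncurry_partialDeriv i).continuousOn
    choose Mf hMf using hb
    refine ⟨∑ i, |Mf i|, fun τ hτ i y => ?_⟩
    have h1 := hMf i (τ, y) (mk_mem_prod hτ (mem_univ _))
    simp only [uncurry] at h1
    exact (h1.trans (le_abs_self _)).trans (Finset.single_le_sum (fun i' _ => abs_nonneg (Mf i')) (Finset.mem_univ i))
  obtain ⟨M, hM⟩ := hMex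
  obtain ⟨Cb, hCb⟩ := exists_norm_partialSum_le E hR m
  have hCb0 : 0 ≤ Cb := (norm_nonneg _).trans (hCb 0 0)
  -- the frame bound on the closed window (joint continuity of the clamped entries on the compact `[0, Tw] × 𝕋³`)
  have hcont : ∀ c i, Continuous (uncurry fun (τ : ℝ) (y : UnitAddTorus (Fin 3)) =>
      frameG E m (w + max 0 (min τ (E.a (m + 1) * (t - w))) / E.a (m + 1)) w y c i) := fun c i => by
    simpa using (smoothFamily_frameG_clamped E hR hF j hjt htR c i).2 []
  have hB : ∃ B : ℝ, 0 ≤ B ∧ ∀ τ ∈ Icc 0 Tw, ∀ (y : UnitAddTorus (Fin 3)) (c i : Fin 3),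
      |frameG E m (w + max 0 (min τ (E.a (m + 1) * (t - w))) / E.a (m + 1)) w y c i| ≤ B := by
    have hK : IsCompact (Icc (0:ℝ) Tw ×ˢ (univ : Set (UnitAddTorus (Fin 3)))) := isCompact_Icc.prod isCompact_univ
    have hb : ∀ c i, ∃ B : ℝ, ∀ p ∈ Icc (0:ℝ) Tw ×ˢ (univ : Set (UnitAddTorus (Fin 3))),
        ‖(uncurry fun (τ : ℝ) (y : UnitAddTorus (Fin 3)) => frameG E m (w + max 0 (min τ (E.a (m + 1) * (t - w))) / E.a (m + 1)) w y c i) p‖ ≤ B :=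
      fun c i => hK.exists_bound_of_continuousOn (hcont c i).continuousOn
    choose Bf hBf using hb
    refine ⟨∑ c, ∑ i, |Bf c i|, by positivity, fun τ hτ y c i => ?_⟩
    have h1 := hBf c i (τ, y) (mk_mem_prod hτ (mem_univ _))
    simp only [uncurry, Real.norm_eq_abs] at h1
    calc |frameG E m (w + max 0 (min τ (E.a (m + 1) * (t - w))) / E.a (m + 1)) w y c i| ≤ |Bf c i| := h1.trans (le_abs_self _)
      _ ≤ ∑ i', |Bf c i'| := Finset.single_le_sum (fun i' _ => abs_nonneg (Bf c i')) (Finset.mem_univ i)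
      _ ≤ ∑ c', ∑ i', |Bf c' i'| := Finset.single_le_sum (fun c' _ => Finset.sum_nonneg fun i' _ => abs_nonneg (Bf c' i')) (Finset.mem_univ c)
  obtain ⟨B, hB0, hB⟩ := hB
  have hM0 : 0 ≤ max M 0 := le_max_right _ _
  set LX : ℝ := (1 + 3 * (3 * B + 1)) * Real.sqrt 3 with hLX
  have hLX0 : 0 ≤ LX := by rw [hLX]; positivity
  refine ⟨LΨ + 3 * max M 0 * Real.sqrt 3 * (LX * (Cb * (1 / E.a (m + 1)))), by positivity, fun τ₁ hτ₁ τ₂ hτ₂ x => ?_⟩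
  -- the two clamped flow times
  set c₁ : ℝ := max 0 (min (σ₁ + τ₁) (E.a (m + 1) * (t - w))) with hc₁
  set c₂ : ℝ := max 0 (min (σ₁ + τ₂) (E.a (m + 1) * (t - w))) with hc₂
  have hc₁I : c₁ ∈ Icc 0 Tw := ⟨le_max_left _ _, max_le hTw0 (min_le_right _ _)⟩
  have hc₂I : c₂ ∈ Icc 0 Tw := ⟨le_max_left _ _, max_le hTw0 (min_le_right _ _)⟩
  set s₁ : ℝ := w + c₁ / E.a (m + 1) with hs₁
  set s₂ : ℝ := w + c₂ / E.a (m + 1) with hs₂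
  set y₁ := E.X m w s₁ x with hy₁
  set y₂ := E.X m w s₂ x with hy₂
  -- split: time at fixed point + space at fixed time
  have hA : ‖Ψ τ₁ y₁ - Ψ τ₂ y₁‖ ≤ LΨ * |τ₁ - τ₂| := hLΨ τ₁ hτ₁ τ₂ hτ₂ y₁
  have hMb : ∀ (i : Fin 3) (y : UnitAddTorus (Fin 3)), ‖Torus.partialDeriv i (Ψ τ₂) y‖ ≤ max M 0 :=
    fun i y => (hM τ₂ hτ₂ i y).trans (le_max_left _ _)
  have hBsp : ‖Ψ τ₂ y₁ - Ψ τ₂ y₂‖ ≤ 3 * max M 0 * Real.sqrt 3 * dist y₁ y₂ :=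
    norm_sub_le_of_partialDeriv_le (hΨ.isSmooth_slice τ₂) hM0 hMb y₁ y₂
  -- `y₂ = X m w s₁ (X m s₁ s₂ x)` and the spatial Lipschitz bound of `X m w s₁`
  set x' := E.X m s₁ s₂ x with hx'
  have hy₂' : y₂ = E.X m w s₁ x' := by
    have h := congrFun (hR.X_comp_X m w s₁ s₂) x
    rw [Function.comp_apply] at h
    rw [hy₂, hx', h]
  have hBx : ∀ (z : UnitAddTorus (Fin 3)) (c i : Fin 3), |frameG E m s₁ w (E.X m w s₁ z) c i| ≤ B := by
    intro z c i
    have h := hB c₁ hc₁I (E.X m w s₁ z) c i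
    rwa [clamp_eq_self hc₁I] at h
  have hdist₁ : dist y₁ y₂ ≤ (1 + 3 * (3 * B + 1)) * (Real.sqrt 3 * dist x x') := by
    rw [hy₂', hy₁]
    exact dist_X_backward_le E hR m w s₁ hB0 hBx x x'
  -- `dist x x' ≤ Cb |s₂ − s₁|` (forward displacement from base `s₂`, `x = X m s₂ s₂ x`)
  have hdist₂ : dist x x' ≤ Cb * |s₂ - s₁| := by
    have h := dist_X_forward_le E hR hF s₂ hCb s₂ s₁ x
    have hxx : E.X m s₂ s₂ x = x := by rw [hR.X_self m s₂]; rfl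
    rw [hxx] at h
    rw [hx']; exact h
  have hds : |s₂ - s₁| ≤ (1 / E.a (m + 1)) * |τ₁ - τ₂| := by
    rw [hs₁, hs₂, show w + c₂ / E.a (m + 1) - (w + c₁ / E.a (m + 1)) = (c₂ - c₁) / E.a (m + 1) by ring, abs_div,
      abs_of_pos ha, div_eq_mul_inv, mul_comm, one_div]
    refine mul_le_mul_of_nonneg_left ?_ (inv_nonneg.2 ha.le)
    rw [hc₁, hc₂, abs_sub_comm]
    have h := abs_clamp_sub_clamp_le (σ₁ + τ₁) (σ₁ + τ₂) (E.a (m + 1) * (t - w))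
    rwa [show σ₁ + τ₁ - (σ₁ + τ₂) = τ₁ - τ₂ by ring] at h
  -- assemble
  calc ‖Ψ τ₁ y₁ - Ψ τ₂ y₂‖ = ‖(Ψ τ₁ y₁ - Ψ τ₂ y₁) + (Ψ τ₂ y₁ - Ψ τ₂ y₂)‖ := by congr 1; abel
    _ ≤ ‖Ψ τ₁ y₁ - Ψ τ₂ y₁‖ + ‖Ψ τ₂ y₁ - Ψ τ₂ y₂‖ := norm_add_le _ _
    _ ≤ LΨ * |τ₁ - τ₂| + 3 * max M 0 * Real.sqrt 3 * dist y₁ y₂ := add_le_add hA hBsp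
    _ ≤ LΨ * |τ₁ - τ₂| + 3 * max M 0 * Real.sqrt 3 * (LX * (Cb * ((1 / E.a (m + 1)) * |τ₁ - τ₂|))) := by
        refine add_le_add le_rfl (mul_le_mul_of_nonneg_left ?_ (by positivity))
        calc dist y₁ y₂ ≤ (1 + 3 * (3 * B + 1)) * (Real.sqrt 3 * dist x x') := hdist₁
          _ = LX * dist x x' := by rw [hLX]; ring
          _ ≤ LX * (Cb * |s₂ - s₁|) := mul_le_mul_of_nonneg_left hdist₂ hLX0
          _ ≤ LX * (Cb * ((1 / E.a (m + 1)) * |τ₁ - τ₂|)) :=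
              mul_le_mul_of_nonneg_left (mul_le_mul_of_nonneg_left hds hCb0) hLX0
    _ = (LΨ + 3 * max M 0 * Real.sqrt 3 * (LX * (Cb * (1 / E.a (m + 1))))) * |τ₁ - τ₂| := by ring

end Summit.AnomalousDissipation.AnomalousDissipation.Theorems.SolenoidalFractalHomogenisation.LagrangianStep.FrameConj

end
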